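/-
Copyright: h21 programme. Stub-ideation companion (k = 2, GENERATION 9, HOME FAMILY 2 — RESHAPE) —
NOT a route file, NOT a Theorems file.  Elaboration sanity: the reshaped target, its PROVED glue to the
registered stub, the PROVED joins, every OPEN helper with its final signature (`sorry`), and — new in this
generation — the k1-g9 discharge of the Tate block copied VERBATIM (§T, credit: ideator k1) so that ONE file
carries the whole road.  Imports no other crux workfile (the farm does not build them as modules:
`lean check` of an `import Summits.ABC.ABC.Cruxes.FreyModularity.STUB_IDEAS_stub_switch_1g9_Sketch`
answers `remote:stale:…:unbuilt`), so shared vocabulary is copied, not imported.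
-/
import Literature.NumberTheory.Automorphic.CDTTheorem712
import Literature.NumberTheory.EllipticCurves.ModFiveCongruenceHesseFamily
import Literature.NumberTheory.EllipticCurves.TorsionFrobenius
import Literature.NumberTheory.EllipticCurves.TorsionFrobeniusChebotarevProofs
import Literature.NumberTheory.EllipticCurves.TateCurve.NumberFieldUniformizationTwistedTateJ
import Literature.NumberTheory.EllipticCurves.TateParametrisationTorsion
import Literature.NumberTheory.EllipticCurves.NeronOggShafarevichLocal
import Literature.NumberTheory.EllipticCurves.MultiplicativeUnipotentTorsionProofs
import Literature.NumberTheory.EllipticCurves.MultiplicativeTransvectionPrimeToVProofs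
import Literature.NumberTheory.EllipticCurves.SerreOpenImageDeterminantProofs
import Literature.NumberTheory.EllipticCurves.MatarNekovar2019.IrreducibleOverQuadraticFieldProofs
import Literature.NumberTheory.EllipticCurves.PeriodIndexLocalTriviality
import Literature.NumberTheory.EllipticCurves.AdditiveReductionRamifiedTorsionLevelProofs
import Literature.NumberTheory.EllipticCurves.GoodReductionUnramifiedProofs
import Literature.NumberTheory.EllipticCurves.DivisionFieldRamificationPrimePowProofs
import Literature.NumberTheory.EllipticCurves.OpenImageMazurCharacterProofs
import Literature.NumberTheory.EllipticCurves.SzpiroLocalDataProofs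
import Literature.NumberTheory.GaloisRepresentations.DecompositionGroupOfCompletion
import Literature.NumberTheory.GaloisRepresentations.IntegralGaloisActionProofs
import Literature.NumberTheory.GaloisRepresentations.ModNCyclotomicCharacter
import Literature.NumberTheory.GaloisRepresentations.HeckeCharacterProofs
import Literature.NumberTheory.DiophantineGeometry.MinimalDiscriminant
import Literature.NumberTheory.DiophantineGeometry.MinimalDiscriminantNormProofs
import Literature.NumberTheory.DiophantineGeometry.LocalReductionFiniteBadPlacesProofs
import Literature.NumberTheory.DiophantineGeometry.LocalReductionHasMultiplicativeReductionAtProofs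
import Mathlib.NumberTheory.Padics.HeightOneSpectrum
import HarnessLib

/-!
# Stub-ideation k = 2, GENERATION 9 (RESHAPE, two techniques deep) for `stub_switch` of crux `FreyModularity`

Companion to `STUB-IDEAS-stub_switch-2.md` (gen 9; supersedes the gen-8 plan, keeps the gen 2–8 road).

ROAD (unchanged): NONSPLIT-CUSP FORCING + SQUARE TRICK — `stub_switch ⇐ CuspForcedSource ⇐
SquareSource ∧ IntegralModel ∧ CuspMemberSource ∧ SurjThreeOfCuspData` (all joins PROVED, §1–§2, §G).

GEN-9 STATE OF THE ROAD.  The Tate block of Piece C (gen-8 T1 `helper_twistedTate_addOneSq_local`,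
T2 `helper_frob_addOneSq_three`) was DISCHARGED by ideator k1 (gen 9, sorry-free, axioms clean); §T below
is that discharge copied verbatim, so T1 is gone and T2 is a THEOREM here.  The two remaining `M−` helpers
of gen 8 are re-cut:

GEN-9 RESHAPE (technique 1 — LOCALISE B8 onto the tree's minimal-model criteria).  `helper_member_multiplicative`
(member elliptic, multiplicative at `q`, `ord_q Δ_min = 5`) is now PROVED GLUE from
  B8c `helper_mult_of_valuations` — PROVED here from `isMinimalAt_of_valuation_c₄_eq_one` (AEC VII Rem. 1.1),
      `hasMultiplicativeReductionAt_of_valuation_c₄_eq_one` (AEC VII Prop. 5.1(b)) and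
      `valuation_Δ_eq_of_isMinimalAt_holds` (AEC VII Prop. 1.3): integral + `v(c₄) = 1` + `v(Δ) = exp(−n)`
      ⇒ multiplicative with `ord_v Δ_min = n`;
  B8d `helper_member_valuations` (S−, OPEN): the four `ℚ`-valuation facts about the member, themselves fed by
  B8a `helper_C4_C6_den` (XS: denominators `17424`, `17424·240`), B8b `helper_padicValRat_eq_zero_of_cube_sub_sq`
      (S−: `ord(x³ − y²) = 5 ⇒ ord x = 0`), the PROVED bridge VAL0 `valuation_eq_exp_neg_padicValRat`
      (`v(x) = exp(−ord_q x)` at `v ∋ q`), `member_c₄`/`member_Δ` (PROVED) and the gen-5 PROVED syzygy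
      `hesse_syzygy_five_m1` (`𝔠₄³ − 𝔠₆² = (c₄³ − c₆²)·𝔇⁵`, `…_2g5_Sketch.lean`).
GEN-9 RESHAPE (technique 2 — SPLIT B6 over the gen-6 KERNEL CERTIFICATE, integrality by MONICITY).
`helper_D_root_mod_q` (`Frob = −1` on `B[5]`, `χ̄₅(Frob) = 1` ⇒ `𝔇_B(·,1)` has a root mod `q`) is now PROVED
GLUE from B6α `helper_fixed_cusp_root` (S: a `φ`-fixed root `ξ ∈ \bar ℚ` of `𝔇(·,1)`, via the certified
cusp identity `D_LL_MM_eq_zero`), B6β `helper_mem_absIntegers_of_D_eq_zero` (XS/S−: `𝔇(·,1)` is MONIC over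
`ℤ`, so `ξ ∈ \bar ℤ` — this removes gen-8's Bézout/`MM ∉ 𝔓` step entirely), B5 (S, unchanged: a
Frobenius-fixed algebraic integer is `≡ a ∈ ℤ (mod 𝔓)`), B6γ `helper_dvd_D_of_sub_mem` (S−:
`𝔇(a,1) ≡ 𝔇(ξ,1) = 0 (mod 𝔓)` and `𝔓 ∩ ℤ = qℤ`).

Disproof honoured: `Disproof.switch_false_without_det` — `det ρ̄ = χ̄₅` onto is used in A2 (and is NECESSARY
for A1: `H = S₃ ⊂ N(C_ns)` alone has no `g` with `g² = −1`); B6α uses `χ̄₅(φ) = 1`, B8/B9 use nothing Galois.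
-/

set_option linter.dupNamespace false
set_option linter.unusedVariables false

noncomputable section

open scoped NumberField Classical Pointwise
open Literature.NumberTheory.EllipticCurves Literature.NumberTheory.EllipticCurves.HesseFamilyFive
open Literature.NumberTheory.Automorphic Literature.NumberTheory.GaloisRepresentations
open Literature.NumberTheory.Automorphic.BCDT WeierstrassCurve Field NumberField IsDedekindDomain Matrix

namespace Summit.ABC.ABC.Cruxes.FreyModularity.StubSwitchK2G9

/-! ## §0 Vocabulary (copied from the gen-2/5/8 companions; `Iff.rfl`-equal) -/

/-- `Sig.stub_switch` verbatim (the registered stub's statement; = `BCDT.CDT_three_five_switch`). -/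
def StubSwitch : Prop :=
  ∀ (W : WeierstrassCurve ℚ) [W.IsElliptic], ¬ 27 ∣ W.conductorNorm ℤ →
    (∀ ρ₃ : ModPGaloisRep ℚ (ZMod 3) 2, W.IsTorsionGaloisRep 3 ρ₃ →
      ¬ ρ₃.IsAbsIrreducibleOverSqrt (-3)) →
    ∀ (ρ : ModPGaloisRep ℚ (ZMod 5) 2), W.IsTorsionGaloisRep 5 ρ → ρ.IsAbsIrreducibleOverSqrt 5 →
    ∃ (W' : WeierstrassCurve ℚ) (_ : W'.IsElliptic), W'.IsTorsionGaloisRep 5 ρ ∧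
      ∃ ρ₃' : ModPGaloisRep ℚ (ZMod 3) 2, W'.IsTorsionGaloisRep 3 ρ₃' ∧
        ρ₃'.IsAbsIrreducibleOverSqrt (-3)

theorem stubSwitch_iff_CDT_three_five_switch : StubSwitch ↔ CDT_three_five_switch := Iff.rfl

/-- Member `E_{l,m}` of Fisher's direct `5`-congruence family of `y² = x³ − 27c₄x − 54c₆`. -/
abbrev member (c₄ c₆ l m : ℚ) : WeierstrassCurve ℚ :=
  ⟨0, 0, 0, -27 * C4 c₄ c₆ l m, -54 * C6 c₄ c₆ l m⟩

/-- The `c₄c₆`-model (= the member at `(l:m) = (1:0)`). -/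
abbrev base (c₄ c₆ : ℚ) : WeierstrassCurve ℚ := ⟨0, 0, 0, -27 * c₄, -54 * c₆⟩

/-- The modulus of the line: `M = 2640·|c₄³ − c₆²|` (`2640 = 2⁴·3·5·11`; `8`, `3`, `5`, `11` and every
prime of bad reduction of the INTEGRAL model `base c₄ c₆` divide it; `11` because of the denominators
`17424 = 2⁴3²11²`, `240` of Fisher's `𝔠₄, 𝔠₆`). -/
def modulus (c₄ c₆ : ℤ) : ℕ := 2640 * (c₄ ^ 3 - c₆ ^ 2).natAbs

/-- **The reshaped 3-side target (gen 2, verbatim).** -/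
def CuspForcedSource : Prop :=
  ∀ (W : WeierstrassCurve ℚ) [W.IsElliptic] (ρ : ModPGaloisRep ℚ (ZMod 5) 2),
    W.IsTorsionGaloisRep 5 ρ → ρ.IsAbsIrreducibleOverSqrt 5 →
    ∃ (W' : WeierstrassCurve ℚ) (_ : W'.IsElliptic), Congr W' W ∧
      W'.HasSurjectiveModNGaloisRep ((3 : ℕ) : ℤ)

/-! ## §1 TOP GLUE (PROVED, gen 2): `CuspForcedSource ⇒ stub_switch` -/

theorem isTorsionGaloisRep_of_congr {W W' : WeierstrassCurve ℚ} (h : Congr W' W)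
    {ρ : ModPGaloisRep ℚ (ZMod 5) 2} (hρ : W.IsTorsionGaloisRep 5 ρ) :
    W'.IsTorsionGaloisRep 5 ρ := by
  obtain ⟨e', he'⟩ := h
  obtain ⟨e, he⟩ := hρ
  refine ⟨e'.trans e, fun σ P => ?_⟩
  rw [AddEquiv.trans_apply, AddEquiv.trans_apply, he', he]

theorem surjective_of_hasSurjectiveModNGaloisRep {F : Type} [Field F] {W : WeierstrassCurve F}
    {p : ℕ} [Fact p.Prime] (hs : W.HasSurjectiveModNGaloisRep (p : ℤ)) {ρ : ModPGaloisRep F (ZMod p) 2}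
    (hρ : W.IsTorsionGaloisRep p ρ) : Function.Surjective ρ := by
  obtain ⟨e, he⟩ := hρ
  intro M
  let f : (Fin 2 → ZMod p) ≃+ (Fin 2 → ZMod p) :=
    { toFun := fun v ↦ (M : Matrix (Fin 2) (Fin 2) (ZMod p)) *ᵥ v
      invFun := fun v ↦ ((M⁻¹ : GL (Fin 2) (ZMod p)) : Matrix (Fin 2) (Fin 2) (ZMod p)) *ᵥ v
      left_inv := fun v ↦ by
        simp only [Matrix.mulVec_mulVec, Units.inv_mul, Matrix.one_mulVec]
      right_inv := fun v ↦ by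
        simp only [Matrix.mulVec_mulVec, Units.mul_inv, Matrix.one_mulVec]
      map_add' := fun v w ↦ Matrix.mulVec_add _ _ _ }
  have hf : ∀ v, f v = (M : Matrix (Fin 2) (Fin 2) (ZMod p)) *ᵥ v := fun _ ↦ rfl
  obtain ⟨σ, hσ⟩ := hs (Multiplicative.ofAdd (e.trans (f.trans e.symm)))
  have hσP : ∀ P : geomTorsion W p, σ • P = e.symm (f (e P)) := fun P ↦ by
    have h := W.galoisRepTorsion_apply (p : ℤ) σ P
    rw [hσ, toAdd_ofAdd] at h
    exact h.symm
  refine ⟨σ, ?_⟩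
  have hv : ∀ v : Fin 2 → ZMod p,
      ((ρ σ : GL (Fin 2) (ZMod p)) : Matrix (Fin 2) (Fin 2) (ZMod p)) *ᵥ v =
        (M : Matrix (Fin 2) (Fin 2) (ZMod p)) *ᵥ v := fun v ↦ by
    have h := he σ (e.symm v)
    rw [hσP, AddEquiv.apply_symm_apply, AddEquiv.apply_symm_apply, hf] at h
    exact h.symm
  have hmat : ((ρ σ : GL (Fin 2) (ZMod p)) : Matrix (Fin 2) (Fin 2) (ZMod p)) =
      (M : Matrix (Fin 2) (Fin 2) (ZMod p)) :=
    Matrix.toLin'.injective (LinearMap.ext fun v ↦ by rw [Matrix.toLin'_apply, Matrix.toLin'_apply, hv])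
  exact Units.ext hmat

/-- **`CuspForcedSource ⇒ stub_switch` (PROVED).** -/
theorem stubSwitch_of_cuspForcedSource (h : CuspForcedSource) : StubSwitch := by
  intro W _ _ _ ρ hρ hirr
  obtain ⟨W', hW', hc, hs⟩ := h W ρ hρ hirr
  haveI := hW'
  haveI : Fact (Nat.Prime 3) := ⟨Nat.prime_three⟩
  haveI : NeZero ((3 : ℕ) : ℚ) := ⟨by norm_num⟩
  obtain ⟨ρ₃, hρ₃⟩ := W'.exists_isTorsionGaloisRep 3
  exact ⟨W', hW', isTorsionGaloisRep_of_congr hc hρ, ρ₃, hρ₃,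
    isAbsIrreducibleOverSqrt_neg_three_of_surjective ρ₃
      (surjective_of_hasSurjectiveModNGaloisRep hs hρ₃)⟩

theorem CDT_three_five_switch_of_cuspForcedSource (h : CuspForcedSource) : CDT_three_five_switch :=
  stubSwitch_iff_CDT_three_five_switch.mp (stubSwitch_of_cuspForcedSource h)

/-! ## §2 THE THREE PIECES (gen-8 cut) and their PROVED join -/

/-- **Piece A `SquareSource` (S, pure group theory + framing): a Galois element whose SQUARE is `−1` on
`W[5]`, with `χ̄₅(τ²) = 1`.**  (= G1a′ `NegOneIsSquare` + G1′.) -/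
def SquareSource : Prop :=
  ∀ (W : WeierstrassCurve ℚ) [W.IsElliptic] (ρ : ModPGaloisRep ℚ (ZMod 5) 2),
    W.IsTorsionGaloisRep 5 ρ → ρ.IsAbsIrreducibleOverSqrt 5 →
    ∃ τ : absoluteGaloisGroup ℚ, (∀ P : W.geomTorsion 5, τ • (τ • P) = -P) ∧
      modNCyclotomicCharacter ℚ 5 (τ * τ) = 1

/-- **Piece I `IntegralModel` (S−, plumbing): every `W/ℚ` is `5`-congruent (indeed `ℚ`-isomorphic) to an
INTEGRAL `c₄c₆`-model.** (`congr_fisherModel`, `scale_smul_short` with `v = d⁶`, `congr_of_smul_eq`.) -/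
def IntegralModel : Prop :=
  ∀ (W : WeierstrassCurve ℚ) [W.IsElliptic], ∃ c₄ c₆ : ℤ, c₄ ^ 3 ≠ c₆ ^ 2 ∧
    ∃ _ : (base (c₄ : ℚ) (c₆ : ℚ)).IsElliptic, Congr (base (c₄ : ℚ) (c₆ : ℚ)) W

/-- **Piece B `CuspMemberSource` (the constructive heart: Chebotarev + cusp forcing + local structure).**
For the integral model `B = base c₄ c₆`, a modulus `M` (multiple of `modulus c₄ c₆`) and `τ` with
`τ² = −1` on `B[5]`, `χ̄₅(τ²) = 1`: there are an integer `l`, a prime `q ∤ M` with its place `v`, a prime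
`𝔓 ∣ q` of `\bar ℤ` and an arithmetic Frobenius `φ` at `𝔓` such that the member `E = E_{l,1}` is
elliptic, `5`-congruent to `B`, semistable away from `M`, multiplicative at `q` with `v_q(Δ_min) = 5`,
and `φ = −1` on `E[5]`, `χ̄₃(φ) = χ̄₅(φ) = 1`, `χ̄_M(φ) = χ̄_M(τ²)`. -/
def CuspMemberSource : Prop :=
  ∀ (c₄ c₆ : ℤ), c₄ ^ 3 ≠ c₆ ^ 2 → ∀ [(base (c₄ : ℚ) (c₆ : ℚ)).IsElliptic] (M : ℕ) [NeZero M]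
    (τ : absoluteGaloisGroup ℚ), modulus c₄ c₆ ∣ M →
    (∀ P : (base (c₄ : ℚ) (c₆ : ℚ)).geomTorsion 5, τ • (τ • P) = -P) →
    modNCyclotomicCharacter ℚ 5 (τ * τ) = 1 →
    ∃ (l : ℤ) (_ : (member (c₄ : ℚ) (c₆ : ℚ) (l : ℚ) 1).IsElliptic) (q : ℕ)
      (v : HeightOneSpectrum (𝓞 ℚ)) (𝔓 : Ideal (absIntegers (𝓞 ℚ) ℚ)) (φ : absoluteGaloisGroup ℚ),
      q.Prime ∧ ¬ q ∣ M ∧ (q : 𝓞 ℚ) ∈ v.asIdeal ∧ 𝔓 ∈ v.primesAbove ∧ IsArithFrobAt (𝓞 ℚ) φ 𝔓 ∧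
      Congr (member (c₄ : ℚ) (c₆ : ℚ) (l : ℚ) 1) (base (c₄ : ℚ) (c₆ : ℚ)) ∧
      (∀ w : HeightOneSpectrum (𝓞 ℚ), (M : 𝓞 ℚ) ∉ w.asIdeal →
        (member (c₄ : ℚ) (c₆ : ℚ) (l : ℚ) 1).IsSemistableAt w) ∧
      (member (c₄ : ℚ) (c₆ : ℚ) (l : ℚ) 1).HasMultiplicativeReductionAt v ∧
      (member (c₄ : ℚ) (c₆ : ℚ) (l : ℚ) 1).ordMinimalDiscriminant v = 5 ∧
      (∀ P : (member (c₄ : ℚ) (c₆ : ℚ) (l : ℚ) 1).geomTorsion 5, φ • P = -P) ∧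
      modNCyclotomicCharacter ℚ 3 φ = 1 ∧ modNCyclotomicCharacter ℚ 5 φ = 1 ∧
      modNCyclotomicCharacter ℚ M φ = modNCyclotomicCharacter ℚ M (τ * τ)

/-- **Piece C `SurjThreeOfCuspData` (Tate + reducible-case contradiction + Serre): the data of Piece B
force `ρ̄_{E,3}` onto `GL₂(𝔽₃)`.** -/
def SurjThreeOfCuspData : Prop :=
  ∀ (E : WeierstrassCurve ℚ) [E.IsElliptic] (M : ℕ) [NeZero M] (q : ℕ) (v : HeightOneSpectrum (𝓞 ℚ))
    (𝔓 : Ideal (absIntegers (𝓞 ℚ) ℚ)) (φ τ : absoluteGaloisGroup ℚ),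
    8 ∣ M → 3 ∣ M →
    (∀ w : HeightOneSpectrum (𝓞 ℚ), (M : 𝓞 ℚ) ∉ w.asIdeal → E.IsSemistableAt w) →
    q.Prime → ¬ q ∣ M → (q : 𝓞 ℚ) ∈ v.asIdeal → 𝔓 ∈ v.primesAbove → IsArithFrobAt (𝓞 ℚ) φ 𝔓 →
    E.HasMultiplicativeReductionAt v → E.ordMinimalDiscriminant v = 5 →
    (∀ P : E.geomTorsion 5, φ • P = -P) →
    modNCyclotomicCharacter ℚ 3 φ = 1 → modNCyclotomicCharacter ℚ 5 φ = 1 →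
    modNCyclotomicCharacter ℚ M φ = modNCyclotomicCharacter ℚ M (τ * τ) →
    E.HasSurjectiveModNGaloisRep ((3 : ℕ) : ℤ)

/-- **THE JOIN (PROVED): `SquareSource ∧ IntegralModel ∧ CuspMemberSource ∧ SurjThreeOfCuspData ⇒
CuspForcedSource`.** -/
theorem cuspForcedSource_of_pieces (hA : SquareSource) (hI : IntegralModel) (hB : CuspMemberSource)
    (hC : SurjThreeOfCuspData) : CuspForcedSource := by
  intro W _ ρ hρ hirr
  obtain ⟨τ, hτ, hχτ⟩ := hA W ρ hρ hirr
  obtain ⟨c₄, c₆, hΔ, hBell, hBW⟩ := hI W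
  haveI := hBell
  haveI : NeZero (modulus c₄ c₆) :=
    ⟨mul_ne_zero (by norm_num) (Int.natAbs_ne_zero.mpr (sub_ne_zero.mpr hΔ))⟩
  have hτB : ∀ P : (base (c₄ : ℚ) (c₆ : ℚ)).geomTorsion 5, τ • (τ • P) = -P := by
    obtain ⟨e, he⟩ := hBW
    intro P
    apply e.injective
    rw [he, he, hτ, map_neg]
  obtain ⟨l, hEll, q, v, 𝔓, φ, hq, hqM, hv, h𝔓, hφ, hcongr, hss, hmult, hord, hneg, h3, h5, hM⟩ :=
    hB c₄ c₆ hΔ (modulus c₄ c₆) τ dvd_rfl hτB hχτ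
  haveI := hEll
  refine ⟨member (c₄ : ℚ) (c₆ : ℚ) (l : ℚ) 1, hEll, congr_trans hcongr hBW, ?_⟩
  exact hC _ (modulus c₄ c₆) q v 𝔓 φ τ (dvd_mul_of_dvd_left (by norm_num) _)
    (dvd_mul_of_dvd_left (by norm_num) _) hss hq hqM hv h𝔓 hφ hmult hord hneg h3 h5 hM

/-- hence the registered stub from the four pieces (PROVED). -/
theorem stubSwitch_of_pieces (hA : SquareSource) (hI : IntegralModel) (hB : CuspMemberSource)
    (hC : SurjThreeOfCuspData) : StubSwitch :=
  stubSwitch_of_cuspForcedSource (cuspForcedSource_of_pieces hA hI hB hC)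

/-! ## §A helpers for `SquareSource` -/

/-- **G1a′ (S; statement VERBATIM = gen-5/gen-7 `NegOneIsSquare`; every finite fact it needs is DECIDED in
`STUB_IDEAS_stub_switch_2g7_Sketch.lean` §2–§3: `orders_SL2`, `invol`, `s3_pair/s3_comm/normC3_gen`,
`u5_pair/u5_comm/normU_gen`, `GL_orders`).**  `G ≤ GL₂(𝔽₅)` with `det G = 𝔽₅ˣ`, `H ≤ G` with
`det(H)² = 1`, `H` without a common eigenline and non-abelian ⇒ some `g ∈ G` has `g² = −1`. -/
def NegOneIsSquare : Prop :=
  ∀ (G H : Subgroup (GL (Fin 2) (ZMod 5))), H ≤ G →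
    (∀ d : (ZMod 5)ˣ, ∃ g ∈ G, Matrix.GeneralLinearGroup.det g = d) →
    (∀ h ∈ H, Matrix.GeneralLinearGroup.det h ^ 2 = 1) →
    (∀ w : Fin 2 → ZMod 5, w ≠ 0 → ∃ h ∈ H, ∀ c : ZMod 5,
      (h : Matrix (Fin 2) (Fin 2) (ZMod 5)) *ᵥ w ≠ c • w) →
    (∃ h₁ ∈ H, ∃ h₂ ∈ H, h₁ * h₂ ≠ h₂ * h₁) →
    ∃ g ∈ G, g * g = -1

/-- G1a′ (S): the sylow-free case analysis of gen 7 §4 over the decided tables. -/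
theorem negOneIsSquare : NegOneIsSquare := by
  sorry

/-- **G1′ (S, framing glue): `G = range ρ̄`, `H = ρ̄(Γ_{ℚ(√5)})`; `det ρ̄ = χ̄₅` onto
(`det_eq_modPCyclotomicCharacter_of_isTorsionGaloisRep_holds`, `χ̄₅` onto over `ℚ`), `χ̄₅² = 1` on
`Γ_{ℚ(√5)}`, no common eigenline / non-abelian from `IsAbsIrreducibleOverSqrt 5`; G1a′ gives `ρ̄(τ)² = −1`,
the frame turns it into `τ • (τ • P) = −P`, and `χ̄₅(τ²) = det(−1) = 1`.** -/
theorem helper_exists_tau_sq_eq_neg (hG : NegOneIsSquare) (W : WeierstrassCurve ℚ) [W.IsElliptic]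
    (ρ : ModPGaloisRep ℚ (ZMod 5) 2) (hρ : W.IsTorsionGaloisRep 5 ρ)
    (hirr : ρ.IsAbsIrreducibleOverSqrt 5) :
    ∃ τ : absoluteGaloisGroup ℚ, (∀ P : W.geomTorsion 5, τ • (τ • P) = -P) ∧
      modNCyclotomicCharacter ℚ 5 (τ * τ) = 1 := by
  sorry

/-- Piece A from G1a′ + G1′ (PROVED glue). -/
theorem squareSource_of (hG : NegOneIsSquare) : SquareSource :=
  fun W _ ρ hρ hirr => helper_exists_tau_sq_eq_neg hG W ρ hρ hirr

/-! ## §I the integral model (S−) -/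

/-- **I0 (S−).** `W ≅ base(W.c₄, W.c₆)` (`congr_fisherModel`), then rescale by `d⁶`, `d` a common
denominator (`scale_smul_short`, `congr_of_smul_eq`, `congr_symm/trans`); `IsElliptic` transports along
variable changes. -/
theorem integralModel : IntegralModel := by
  sorry

/-! ## §B helpers for `CuspMemberSource`
B1 is the TREE fact `chebotarev_geomTorsion_holds` (applied to `base`, level `n = M`, `σ = τ * τ`,
`S = {p : p ∣ M}`); F1 is the tree NAMED FACT `thm132_geomTorsionFive_of_hesseFamily`. -/

/-- **B2 (XS): equal actions on `W[n]` restrict to `W[d]`, `d ∣ n`.** -/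
theorem helper_smul_eq_of_dvd (W : WeierstrassCurve ℚ) {d n : ℤ} (hdn : d ∣ n)
    {φ σ : absoluteGaloisGroup ℚ} (h : ∀ P : W.geomTorsion n, φ • P = σ • P)
    (P : W.geomTorsion d) : φ • P = σ • P := by
  sorry

/-- **B3 = G2 (S): equal actions on `W[n]` ⇒ equal `χ̄_n`** (`det ρ̄_{W,n} = χ̄_n`: tree PROVED
`det_eq_modNCyclotomicCharacter`, one frame of `W[n]` for both elements). -/
theorem helper_cyclotomic_eq_of_smul_eq (W : WeierstrassCurve ℚ) [W.IsElliptic] {n : ℕ} [NeZero n]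
    (hn : 2 ≤ n) {φ σ : absoluteGaloisGroup ℚ} (h : ∀ P : W.geomTorsion n, φ • P = σ • P) :
    modNCyclotomicCharacter ℚ n φ = modNCyclotomicCharacter ℚ n σ := by
  sorry

/-- `(ℤ/3)ˣ` has exponent `2` (PROVED, `decide`). -/
theorem units_zmod3_mul_self (x : (ZMod 3)ˣ) : x * x = 1 := by
  revert x; decide

/-- **B4 (PROVED, XS): `χ̄₃(τ²) = 1`.** -/
theorem helper_chi3_sq (τ : absoluteGaloisGroup ℚ) : modNCyclotomicCharacter ℚ 3 (τ * τ) = 1 := by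
  rw [map_mul]; exact units_zmod3_mul_self _

/-- **B5 = C1-i (S): a Frobenius-fixed algebraic integer is congruent to a rational integer mod `𝔓`.** -/
theorem helper_exists_int_congr_of_frob_fixed {v : HeightOneSpectrum (𝓞 ℚ)}
    {𝔓 : Ideal (absIntegers (𝓞 ℚ) ℚ)} (h𝔓 : 𝔓 ∈ v.primesAbove)
    {φ : absoluteGaloisGroup ℚ} (hφ : IsArithFrobAt (𝓞 ℚ) φ 𝔓)
    (A : absIntegers (𝓞 ℚ) ℚ) (hA : φ • A = A) : ∃ a : ℤ, A - a ∈ 𝔓 := by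
  sorry

/-! ### B6 RE-CUT (gen 9, RESHAPE technique 2 — SPLIT the `M−` cusp step over the gen-6 KERNEL
CERTIFICATE; integrality from the MONICITY of `𝔇(·,1)`, not from a denominator bound) -/

/-- **B6α (S; every step kernel-side or routine): a `φ`-fixed root of Fisher's `𝔇_B(·,1)` in `\bar ℚ`.**
From `φ = −1` on `B[5]`: a non-zero `T = (x,y) ∈ B[5]` (`exists_isTorsionGaloisRep 5` gives
`B[5] ≃+ 𝔽₅²`) has `φx = x` (`φT = −T`; negation fixes `x` on a short model; the action is coordinatewise,
`Affine.Point.map_some`), `y ≠ 0` (`T` has odd order) and `ψ₅(x) = 0` (`PSI5_eq_zero_of_five_torsion`,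
`…_2g6_Cert.lean`, from `zsmul_some_eq_zero_iff_eval_ΨSq`); a primitive 5th root of unity `ζ ∈ \bar ℚ`
(`exists_isPrimitiveRoot_absIntegers`) has `φζ = ζ^{χ̄₅(φ)} = ζ` (`smul_eq_pow_modNCyclotomicCharacter`, `hζ`),
so `p := ζ + ζ⁴` is `φ`-fixed with `p² + p − 1 = 0` (`IsPrimitiveRoot.geom_sum_eq_zero`); the KERNEL-CERTIFIED
cusp identity `D_LL_MM_eq_zero` (`…_2g6_Cert.lean`, any field) gives `𝔇(LL(x,p), MM(x)) = 0` with
`MM(x) = 12y² ≠ 0` (`MM_eq_twelve_mul_sq`), hence `ξ := LL/MM` is a root of `𝔇(·,1)` by homogeneity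
(`helper_D_smul`, gen 4 PROVED) fixed by the ring automorphism `φ` (it fixes `x`, `p`, `ℚ`). -/
theorem helper_fixed_cusp_root (c₄ c₆ : ℤ) (hΔ : c₄ ^ 3 ≠ c₆ ^ 2) [(base (c₄ : ℚ) (c₆ : ℚ)).IsElliptic]
    {φ : absoluteGaloisGroup ℚ} (hζ : modNCyclotomicCharacter ℚ 5 φ = 1)
    (hneg : ∀ P : (base (c₄ : ℚ) (c₆ : ℚ)).geomTorsion 5, φ • P = -P) :
    ∃ ξ : AlgebraicClosure ℚ, φ • ξ = ξ ∧
      D (c₄ : AlgebraicClosure ℚ) (c₆ : AlgebraicClosure ℚ) ξ 1 = 0 := by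
  sorry

/-- **B6β (XS/S−): a root of the MONIC integer polynomial `𝔇(·,1)` (leading term `l¹²`,
`ModFiveCongruenceHessePolynomials.D`) is an algebraic integer** — `IsIntegral ℤ ξ` witnessed by the
explicit monic `Polynomial ℤ` whose `aeval ξ` is `D c₄ c₆ ξ 1`, then `mem_integralClosure_iff` +
`IsIntegral.tower_top` (`ℤ → 𝓞 ℚ`).  Replaces gen-8's "`MM ∉ 𝔓` by a Bézout identity". -/
theorem helper_mem_absIntegers_of_D_eq_zero (c₄ c₆ : ℤ) {ξ : AlgebraicClosure ℚ}
    (hξ : D (c₄ : AlgebraicClosure ℚ) (c₆ : AlgebraicClosure ℚ) ξ 1 = 0) :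
    ξ ∈ absIntegers (𝓞 ℚ) ℚ := by
  sorry

/-- **B6γ (S−): the reduction mod `𝔓` of an integral root lands in `qℤ`.**  If `A ∈ \bar ℤ` is a root
of `𝔇(·,1)` and `A ≡ a (mod 𝔓)` with `a ∈ ℤ`, then `𝔇(a,1) − 𝔇(A,1) ∈ (a − A) ⊆ 𝔓`
(`Polynomial.sub_dvd_eval_sub` on the univariate integer polynomial, mapped by `algebraMap ℤ \bar ℤ`;
`helper_map_D`), so `(𝔇(a,1) : \bar ℤ) ∈ 𝔓` and `𝔓 ∩ ℤ = qℤ` (`h𝔓.2.over`, `Ideal.mem_comap`,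
`Rat.intCast_mem_asIdeal_iff`, `Rat.HeightOneSpectrum.natGenerator` `= q` by `natGenerator_eq_of_mem`;
pattern of the tree's `Rat.natCast_not_mem_of_mem_primesAbove_of_not_dvd`). -/
theorem helper_dvd_D_of_sub_mem (c₄ c₆ : ℤ) {q : ℕ} (hq : q.Prime) {v : HeightOneSpectrum (𝓞 ℚ)}
    (hv : (q : 𝓞 ℚ) ∈ v.asIdeal) {𝔓 : Ideal (absIntegers (𝓞 ℚ) ℚ)} (h𝔓 : 𝔓 ∈ v.primesAbove)
    {A : absIntegers (𝓞 ℚ) ℚ}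
    (hA : D (c₄ : AlgebraicClosure ℚ) (c₆ : AlgebraicClosure ℚ) (A : AlgebraicClosure ℚ) 1 = 0)
    {a : ℤ} (ha : A - a ∈ 𝔓) : (q : ℤ) ∣ D c₄ c₆ a 1 := by
  sorry

/-- **B6 (gen-8 signature VERBATIM; `M−` in gen 8) — now PROVED GLUE from B6α + B6β + B5 + B6γ.**
The `Γ_ℚ`-action on `\bar ℤ` is the restriction of the action on `\bar ℚ` (`integralClosure.coe_smul`, `rfl`). -/
theorem helper_D_root_mod_q (c₄ c₆ : ℤ) (hΔ : c₄ ^ 3 ≠ c₆ ^ 2) [(base (c₄ : ℚ) (c₆ : ℚ)).IsElliptic]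
    {q : ℕ} (hq : q.Prime) (hq0 : ¬ (q : ℤ) ∣ 30 * (c₄ ^ 3 - c₆ ^ 2))
    {v : HeightOneSpectrum (𝓞 ℚ)} (hv : (q : 𝓞 ℚ) ∈ v.asIdeal)
    {𝔓 : Ideal (absIntegers (𝓞 ℚ) ℚ)} (h𝔓 : 𝔓 ∈ v.primesAbove)
    {φ : absoluteGaloisGroup ℚ} (hφ : IsArithFrobAt (𝓞 ℚ) φ 𝔓)
    (hζ : modNCyclotomicCharacter ℚ 5 φ = 1)
    (hneg : ∀ P : (base (c₄ : ℚ) (c₆ : ℚ)).geomTorsion 5, φ • P = -P) :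
    ∃ r : ℤ, (q : ℤ) ∣ D c₄ c₆ r 1 := by
  obtain ⟨ξ, hfix, hroot⟩ := helper_fixed_cusp_root c₄ c₆ hΔ hζ hneg
  have hint : ξ ∈ absIntegers (𝓞 ℚ) ℚ := helper_mem_absIntegers_of_D_eq_zero c₄ c₆ hroot
  obtain ⟨a, ha⟩ := helper_exists_int_congr_of_frob_fixed h𝔓 hφ ⟨ξ, hint⟩
    (Subtype.ext (by rw [integralClosure.coe_smul]; exact hfix))
  exact ⟨a, helper_dvd_D_of_sub_mem c₄ c₆ hq hv h𝔓 (A := ⟨ξ, hint⟩) hroot ha⟩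

/-- **B7 = C1s′ + C2 (S): a root mod `q ∤ 30(c₄³−c₆²)` lifts to `l ∈ ℤ` with `v_q(𝔇(l,1)) = 1`.**
The root is SIMPLE by the PROVED Bézout certificate `bezout_D_Dl`
(`BU·𝔇 + BV·𝔇_λ = −2¹⁸3¹⁰5⁴(c₄³−c₆²)⁴`, `…_2g7_Sketch.lean`, `helper_simple_root_mod_q` PROVED there);
then `𝔇(r+q) ≡ 𝔇(r) + q·𝔇_λ(r) (mod q²)`, so `l ∈ {r, r+q}` works. -/
theorem helper_lift_root {q : ℕ} (hq : q.Prime) (c₄ c₆ r : ℤ)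
    (hq0 : ¬ (q : ℤ) ∣ 30 * (c₄ ^ 3 - c₆ ^ 2)) (hr : (q : ℤ) ∣ D c₄ c₆ r 1) :
    ∃ l : ℤ, padicValInt q (D c₄ c₆ l 1) = 1 := by
  sorry

/-! ### B8 RE-CUT (gen 9, RESHAPE technique 1 — LOCALISE onto the tree's minimal-model criteria
`isMinimalAt_of_valuation_c₄_eq_one` (AEC VII Rem. 1.1), `hasMultiplicativeReductionAt_of_valuation_c₄_eq_one`
(AEC VII Prop. 5.1(b)), `valuation_Δ_eq_of_isMinimalAt_holds` (AEC VII Prop. 1.3); what remains OPEN is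
`ℚ`-valuation arithmetic on Fisher's closed forms) -/

/-- the prime under a place of `ℚ` containing `q` is `q` (PROVED, XS; pattern of the tree's private
`primesEquiv_eq_of_natCast_mem`). -/
theorem natGenerator_eq_of_mem {q : ℕ} (hq : q.Prime) {v : HeightOneSpectrum (𝓞 ℚ)}
    (hv : (q : 𝓞 ℚ) ∈ v.asIdeal) : Rat.HeightOneSpectrum.natGenerator v = q := by
  have h1 : Rat.HeightOneSpectrum.natGenerator v ∣ q := by
    rw [Rat.HeightOneSpectrum.natGenerator_dvd_iff]
    have h2 := Ideal.mem_map_of_mem (Rat.IsIntegralClosure.intEquiv (𝓞 ℚ)) hv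
    rwa [map_natCast] at h2
  exact (Nat.prime_dvd_prime_iff_eq (Rat.HeightOneSpectrum.prime_natGenerator v) hq).mp h1

/-- **VAL0 (PROVED; the bridge `v(x) = exp(−ord_q x)` at the place `v ∋ q` — private in the tree as
`CPMuDescent.valuation_eq_exp_neg_padicValRat`, restated with `q` in place of `natGenerator v`).** -/
theorem valuation_eq_exp_neg_padicValRat {q : ℕ} (hq : q.Prime) {v : HeightOneSpectrum (𝓞 ℚ)}
    (hv : (q : 𝓞 ℚ) ∈ v.asIdeal) {x : ℚ} (hx : x ≠ 0) :
    v.valuation ℚ x = WithZero.exp (-padicValRat q x) := by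
  rw [← natGenerator_eq_of_mem hq hv]
  haveI hp : Fact (Rat.HeightOneSpectrum.natGenerator v).Prime :=
    ⟨Rat.HeightOneSpectrum.prime_natGenerator v⟩
  haveI hp' : Fact (Nat.Prime ((Rat.HeightOneSpectrum.primesEquiv v : Nat.Primes) : ℕ)) :=
    ⟨(Rat.HeightOneSpectrum.primesEquiv v).2⟩
  have hequiv := Rat.HeightOneSpectrum.valuation_equiv_padicValuation v
  set n : ℤ := padicValRat (Rat.HeightOneSpectrum.natGenerator v) x with hn
  have h2x : Rat.padicValuation (Rat.HeightOneSpectrum.primesEquiv v) x = WithZero.exp (-n) := by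
    change Rat.padicValuation (Rat.HeightOneSpectrum.natGenerator v) x = _
    simp [Rat.padicValuation, hx, hn]
  have h2p : Rat.padicValuation (Rat.HeightOneSpectrum.primesEquiv v)
      ((Rat.HeightOneSpectrum.natGenerator v : ℚ) ^ n) = WithZero.exp (-n) := by
    change Rat.padicValuation (Rat.HeightOneSpectrum.natGenerator v) _ = _
    rw [map_zpow₀, Rat.padicValuation_self, ← WithZero.exp_zsmul]
    simp
  have h1p : v.valuation ℚ ((Rat.HeightOneSpectrum.natGenerator v : ℚ) ^ n) = WithZero.exp (-n) := by
    rw [map_zpow₀, Literature.NumberTheory.GaloisRepresentations.Rat.valuation_natGenerator,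
      ← WithZero.exp_zsmul]
    simp
  rw [← h1p]
  exact (hequiv.eq_iff).mpr (h2x.trans h2p.symm)

/-- `c₄` of a member (PROVED, gen 5; `6⁴ = 1296`). -/
theorem member_c₄ (c₄ c₆ l m : ℚ) : (member c₄ c₆ l m).c₄ = 6 ^ 4 * C4 c₄ c₆ l m := by
  simp only [WeierstrassCurve.c₄, WeierstrassCurve.b₂, WeierstrassCurve.b₄]; ring

/-- `Δ` of a member (PROVED, gen 5). With the gen-5 PROVED syzygy `hesse_syzygy_five_m1`
(`𝔠₄³ − 𝔠₆² = (c₄³ − c₆²)·𝔇(l,1)⁵`, `…_2g5_Sketch.lean`, ≈ 70 s `field_simp; ring`, not re-run here)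
this is `Δ(E_{l,1}) = 2⁶3⁹(c₄³ − c₆²)𝔇(l,1)⁵`. -/
theorem member_Δ (c₄ c₆ l m : ℚ) :
    (member c₄ c₆ l m).Δ = 2 ^ 6 * 3 ^ 9 * (C4 c₄ c₆ l m ^ 3 - C6 c₄ c₆ l m ^ 2) := by
  simp only [WeierstrassCurve.Δ, WeierstrassCurve.b₂, WeierstrassCurve.b₄, WeierstrassCurve.b₆,
    WeierstrassCurve.b₈]
  ring

/-- **B8a (XS, casts only): at integer arguments Fisher's `𝔠₄, 𝔠₆` have denominators `17424 = 2⁴3²11²` and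
`17424·240 = 2⁸3³5·11²`** (read off `ModFiveCongruenceHessePolynomials.C4/C6/C4l/C4m`: the numerators are
integer polynomials; `push_cast [C4, C6, C4l, C4m, Dll, Dlm, Dmm, Dl, Dm, …]`, `ring`). -/
theorem helper_C4_C6_den (c₄ c₆ l : ℤ) :
    (∃ z : ℤ, C4 (c₄ : ℚ) (c₆ : ℚ) (l : ℚ) 1 = (z : ℚ) / 17424) ∧
      ∃ z : ℤ, C6 (c₄ : ℚ) (c₆ : ℚ) (l : ℚ) 1 = (z : ℚ) / (17424 * 240) := by
  sorry

/-- **B8b (S−, pure valuation arithmetic — the gen-5 "VAL" lemma, restated with both conclusions):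
`q`-integral `x, y` with `ord_q(x³ − y²) = 5` force `x ≠ 0` and `ord_q x = 0`** (`ord(x³) = 3a` and
`ord(y²) = 2b` are never `5`; if unequal the difference has `ord = min ≠ 5`, if equal then `6 ∣ 3a`, so
`a ≥ 2` and `ord ≥ 6`; `a = 0` is the only case; `padicValRat.pow`, `padicValRat.min_le_padicValRat_add`,
`padicValRat.add_eq_min`). -/
theorem helper_padicValRat_eq_zero_of_cube_sub_sq {q : ℕ} [Fact q.Prime] {x y : ℚ}
    (hx : x = 0 ∨ 0 ≤ padicValRat q x) (hy : y = 0 ∨ 0 ≤ padicValRat q y) (hxy : x ^ 3 - y ^ 2 ≠ 0)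
    (h5 : padicValRat q (x ^ 3 - y ^ 2) = 5) : x ≠ 0 ∧ padicValRat q x = 0 := by
  sorry

/-- **B8c (PROVED from the tree, the LOCALISED criterion): an integral equation with unit `c₄` and
`v(Δ) = exp(−n)`, `n > 0`, is multiplicative at `v` with `ord_v Δ_min = n`.** -/
theorem helper_mult_of_valuations (W : WeierstrassCurve ℚ) [W.IsElliptic]
    {v : HeightOneSpectrum (𝓞 ℚ)} (hW : W.IsIntegralAt v) (hc₄ : v.valuation ℚ W.c₄ = 1) {n : ℕ}
    (hn : 0 < n) (hΔ : v.valuation ℚ W.Δ = WithZero.exp (-(n : ℤ))) :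
    W.HasMultiplicativeReductionAt v ∧ W.ordMinimalDiscriminant v = n := by
  have hlt : v.valuation ℚ W.Δ < 1 := by
    rw [hΔ, ← WithZero.exp_zero, WithZero.exp_lt_exp]; omega
  refine ⟨hasMultiplicativeReductionAt_of_valuation_c₄_eq_one hW hc₄ hlt, ?_⟩
  have h := valuation_Δ_eq_of_isMinimalAt_holds v W (isMinimalAt_of_valuation_c₄_eq_one hW hc₄)
  rw [hΔ, WithZero.exp_inj] at h
  omega

/-- **B8d (S−, OPEN; bookkeeping valuations of the member at `v ∋ q`, `q ∤ 330(c₄³−c₆²)`, `v_q(𝔇(l,1)) = 1`):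
`Δ ≠ 0`, the member is `v`-integral, `v(c₄) = 1`, `v(Δ) = exp(−5)`.**  Recipe: `x := 𝔠₄(l,1)`,
`y := 𝔠₆(l,1)` are `q`-integral (B8a, `q ∤ 2·3·5·11`); `x³ − y² = (c₄³ − c₆²)𝔇(l,1)⁵` (gen-5 PROVED
`hesse_syzygy_five_m1`) has `ord_q = 0 + 5·1` (`padicValRat.mul/pow`, `padicValRat.of_int` + `hl`); so
`ord_q x = 0` (B8b); `member_c₄ = 6⁴x`, `member_Δ = 2⁶3⁹(x³ − y²)`; convert with VAL0
(`valuation_eq_exp_neg_padicValRat`) and `isIntegralAt_of_valuation_le_one` (`a₁ = a₂ = a₃ = 0`,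
`a₄ = −27x`, `a₆ = −54y`). -/
theorem helper_member_valuations (c₄ c₆ l : ℤ) (hΔ : c₄ ^ 3 ≠ c₆ ^ 2) {q : ℕ} (hq : q.Prime)
    (hq0 : ¬ (q : ℤ) ∣ 330 * (c₄ ^ 3 - c₆ ^ 2)) (hl : padicValInt q (D c₄ c₆ l 1) = 1)
    {v : HeightOneSpectrum (𝓞 ℚ)} (hv : (q : 𝓞 ℚ) ∈ v.asIdeal) :
    (member (c₄ : ℚ) (c₆ : ℚ) (l : ℚ) 1).Δ ≠ 0 ∧
      (member (c₄ : ℚ) (c₆ : ℚ) (l : ℚ) 1).IsIntegralAt v ∧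
      v.valuation ℚ (member (c₄ : ℚ) (c₆ : ℚ) (l : ℚ) 1).c₄ = 1 ∧
      v.valuation ℚ (member (c₄ : ℚ) (c₆ : ℚ) (l : ℚ) 1).Δ = WithZero.exp (-(5 : ℤ)) := by
  sorry

/-- **B8 (gen-8 signature VERBATIM; `M−` in gen 8) — now PROVED GLUE from B8d + B8c.** -/
theorem helper_member_multiplicative (c₄ c₆ l : ℤ) (hΔ : c₄ ^ 3 ≠ c₆ ^ 2) {q : ℕ} (hq : q.Prime)
    (hq0 : ¬ (q : ℤ) ∣ 330 * (c₄ ^ 3 - c₆ ^ 2)) (hl : padicValInt q (D c₄ c₆ l 1) = 1)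
    {v : HeightOneSpectrum (𝓞 ℚ)} (hv : (q : 𝓞 ℚ) ∈ v.asIdeal) :
    ∃ (_ : (member (c₄ : ℚ) (c₆ : ℚ) (l : ℚ) 1).IsElliptic),
      (member (c₄ : ℚ) (c₆ : ℚ) (l : ℚ) 1).HasMultiplicativeReductionAt v ∧
      (member (c₄ : ℚ) (c₆ : ℚ) (l : ℚ) 1).ordMinimalDiscriminant v = 5 := by
  obtain ⟨hΔ0, hint, hc4, hval⟩ := helper_member_valuations c₄ c₆ l hΔ hq hq0 hl hv
  haveI hE : (member (c₄ : ℚ) (c₆ : ℚ) (l : ℚ) 1).IsElliptic := ⟨isUnit_iff_ne_zero.mpr hΔ0⟩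
  exact ⟨hE, helper_mult_of_valuations _ hint hc4 (n := 5) (by norm_num) (by rw [hval]; norm_cast)⟩

/-- **F1 (PROVED, 2 lines): Fisher's Theorem 13.2 (tree NAMED FACT) as a `Congr`.** -/
theorem congr_member_base (hF : thm132_geomTorsionFive_of_hesseFamily) (c₄ c₆ l : ℚ)
    [hE : (base c₄ c₆).IsElliptic] [hE' : (member c₄ c₆ l 1).IsElliptic] :
    Congr (member c₄ c₆ l 1) (base c₄ c₆) := by
  obtain ⟨e, he⟩ := hF (base c₄ c₆) (member c₄ c₆ l 1) c₄ c₆ l 1 rfl rfl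
  exact ⟨e, he⟩

/-- **B9 = N1′ (S, NOW TREE-BACKED): the member is semistable at every `w ∤ 30(c₄³−c₆²)`.**
`base` is an integral short model with `Δ = 2⁶3⁹(c₄³−c₆²)` a `w`-unit ⇒ good at `w`
(`hasGoodReductionAt_of_valuation_le_one_of_valuation_Δ_eq_one`) ⇒ the inertia group of
`𝔓₀ = adicCompletionPrime ℚ w` acts trivially on `base[5]` (`smul_geomTorsion_eq_of_mem_inertia`, `w ∤ 5`)
⇒ via the equivariant `e` of `Congr` trivially on `member[5]` ⇒ not additive
(contrapositive of `exists_mem_inertia_smul_geomTorsion_ne_of_hasAdditiveReductionAt`, `m = 5 ≥ 3`,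
`w ∤ 5`; bridge `GreenbergSelmer.inertia w = 𝔓₀.inertia Γ_ℚ` = `inertia_adicCompletionPrime_eq_map_absInertia`,
`adicCompletionPrime_mem_primesAbove`) ⇒ semistable (`isSemistableAt_iff_not_hasAdditiveReductionAt`). -/
theorem helper_isSemistableAt_member (c₄ c₆ l : ℤ) (hΔ : c₄ ^ 3 ≠ c₆ ^ 2)
    [(base (c₄ : ℚ) (c₆ : ℚ)).IsElliptic] [(member (c₄ : ℚ) (c₆ : ℚ) (l : ℚ) 1).IsElliptic]
    (hc : Congr (member (c₄ : ℚ) (c₆ : ℚ) (l : ℚ) 1) (base (c₄ : ℚ) (c₆ : ℚ)))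
    {w : HeightOneSpectrum (𝓞 ℚ)} (hw : ((30 * (c₄ ^ 3 - c₆ ^ 2).natAbs : ℕ) : 𝓞 ℚ) ∉ w.asIdeal) :
    (member (c₄ : ℚ) (c₆ : ℚ) (l : ℚ) 1).IsSemistableAt w := by
  sorry

/-! ## §C helpers for `SurjThreeOfCuspData` -/

/-! ### §T  THE TATE BLOCK — DISCHARGED (ideator k1, gen 9; copied VERBATIM from
`STUB_IDEAS_stub_switch_1g9_Sketch.lean`, namespace `…StubSwitchK1G9`, lines 108–388, sorry-free, axioms
`[propext, Classical.choice, Quot.sound]`; the only edit is the name `helper_frob_addOneSq_three'` ↦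
`helper_frob_addOneSq_three` = gen-8 T2's name and signature, so §G consumes it unchanged; gen-8 T1 is deleted).
Credit and maintenance: k1.  Included here because crux workfiles cannot be imported on the farm. -/

/-! #### §T.1 (k1) The eigenline re-cut of the Tate block (helpers E1–E7)

Notation: `K_v = v.adicCompletion K`, `K̄_v = AlgebraicClosure K_v`, `Ψ : K̄_vˣ → E(K̄_v)` a TWISTED Tate
parametrisation with kernel `q^ℤ` and sign `ε : Γ_{K_v} → {±1}` (`σ • Ψ(u) = ε σ • Ψ(σ u)`), as delivered by
`TateCurve.exists_twistedTateUniformisation_tateJ` with `ε σ = if σ t = t then 1 else -1`. -/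

section Local

variable {K : Type} [Field K] [NumberField K] (W : WeierstrassCurve K) (v : HeightOneSpectrum (𝓞 K))

/-- **E1 (PROVED here; pure import) — the Tate EIGENPOINT.** For a root of unity `u ∈ K̄_vˣ` of prime
order `p`, `L := Ψ(u)` is a non-zero `p`-torsion point, and every `σ ∈ Γ_{K_v}` FIXING `u` acts on `L`
by the sign `ε σ`.  (`map_ofMul_ne_zero_of_pow_eq_one`, `zsmul_map_ofMul_eq_zero_of_pow_eq_one`, `htw`.)
Replaces the "shape on ALL `p₁p₂`-torsion" of k2-g8 T1: only the eigenpoint is needed downstream. -/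
theorem helper_tate_eigenpoint_local {q : v.adicCompletion K} (hq0 : q ≠ 0) (hq1 : Valued.v q < 1)
    (Ψ : Additive (AlgebraicClosure (v.adicCompletion K))ˣ →+ localPoints W (v.adicCompletion K))
    (hker : ∀ u : (AlgebraicClosure (v.adicCompletion K))ˣ, Ψ (Additive.ofMul u) = 0 ↔
      ∃ n : ℤ, (u : AlgebraicClosure (v.adicCompletion K)) =
        algebraMap (v.adicCompletion K) (AlgebraicClosure (v.adicCompletion K)) q ^ n)
    (ε : absoluteGaloisGroup (v.adicCompletion K) → ℤ)
    (htw : ∀ (σ : absoluteGaloisGroup (v.adicCompletion K))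
        (u : (AlgebraicClosure (v.adicCompletion K))ˣ),
      σ • Ψ (Additive.ofMul u) = ε σ • Ψ (Additive.ofMul (Units.map
        (Field.absoluteGaloisGroup.toAlgEquiv (v.adicCompletion K) σ :
          AlgebraicClosure (v.adicCompletion K) →* AlgebraicClosure (v.adicCompletion K)) u)))
    {p : ℕ} [Fact p.Prime] {u : (AlgebraicClosure (v.adicCompletion K))ˣ} (hup : u ^ p = 1)
    (hu1 : u ≠ 1) :
    Ψ (Additive.ofMul u) ≠ 0 ∧ (p : ℤ) • Ψ (Additive.ofMul u) = 0 ∧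
      ∀ σ : absoluteGaloisGroup (v.adicCompletion K),
        Field.absoluteGaloisGroup.toAlgEquiv (v.adicCompletion K) σ u = u →
          σ • Ψ (Additive.ofMul u) = ε σ • Ψ (Additive.ofMul u) := by
  refine ⟨map_ofMul_ne_zero_of_pow_eq_one (W := W) (v := v) hq0 hq1 Ψ hker hup hu1,
    zsmul_map_ofMul_eq_zero_of_pow_eq_one (W := W) (v := v) Ψ hup, fun σ hσ ↦ ?_⟩
  have hfix : Units.map (Field.absoluteGaloisGroup.toAlgEquiv (v.adicCompletion K) σ :
      AlgebraicClosure (v.adicCompletion K) →* AlgebraicClosure (v.adicCompletion K)) u = u :=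
    Units.ext (by simpa using hσ)
  simpa only [hfix] using htw σ u

/-- **E1′ (PROVED here) — roots of unity of `K̄` give the units `u` of E1**, fixed by every
`σ ∈ Γ_{K_v}` whose restriction fixes them in `K̄` (IMPORT 6). -/
theorem helper_unit_of_closureEmb {p : ℕ} (hp : p.Prime) {ζ : AlgebraicClosure K} (hζp : ζ ^ p = 1)
    (hζ1 : ζ ≠ 1) :
    ∃ u : (AlgebraicClosure (v.adicCompletion K))ˣ,
      (u : AlgebraicClosure (v.adicCompletion K)) = closureEmb (K := K) (v.adicCompletion K) ζ ∧
      u ^ p = 1 ∧ u ≠ 1 ∧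
      ∀ σ : absoluteGaloisGroup (v.adicCompletion K), resGal (K := K) (v.adicCompletion K) σ • ζ = ζ →
        Field.absoluteGaloisGroup.toAlgEquiv (v.adicCompletion K) σ u = u := by
  have hζu : IsUnit (closureEmb (K := K) (v.adicCompletion K) ζ) :=
    (IsUnit.of_pow_eq_one hζp hp.ne_zero).map _
  refine ⟨hζu.unit, rfl, Units.ext ?_, fun h ↦ hζ1 ?_, fun σ hσ ↦ ?_⟩
  · rw [Units.val_pow_eq_pow_val, IsUnit.unit_spec, ← map_pow, hζp, map_one, Units.val_one]
  · have h' := congrArg Units.val h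
    rw [IsUnit.unit_spec, Units.val_one, ← map_one (closureEmb (K := K) (v.adicCompletion K))] at h'
    exact (closureEmb (K := K) (v.adicCompletion K)).injective h'
  · rw [IsUnit.unit_spec, ← Field.absoluteGaloisGroup.smul_def, ← closureEmb_resGal_smul, hσ]

end Local

section Global

variable {K : Type} [Field K] [NumberField K] (W : WeierstrassCurve K) [W.IsElliptic]
  {v : HeightOneSpectrum (𝓞 K)}

/-- **E2 (PROVED here from E1, E1′ and IMPORTS 1, 5) — the GLOBAL Tate eigenline with a COMMON sign.**  At a multiplicative place `v`
there is ONE sign function `ε : Γ_{K_v} → {±1}` (the unramified quadratic twist of Silverman V.5.3,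
trivial iff split) such that for EVERY prime `p` and every non-trivial `p`-th root of unity `ζ ∈ K̄`,
some non-zero `P ∈ E[p](K̄)` satisfies `σ|_{K̄} • P = ε σ • P` for all `σ ∈ Γ_{K_v}` with `σ|_{K̄} ζ = ζ`.
Proof plan (pattern of PROVED `exists_unipotent_of_hasMultiplicativeReductionAt`): IMPORT 1 → `ε`;
E1′ → `u`; E1 → `L = Ψ(u)`; IMPORT 5 → global `P` with `pointsMap P = L`; `pointsMap_smul` +
`pointsMapOfEmb_injective` transport the eigen-relation.  No `hζ`, no `p ∤ v`, uniform in `char k_v`. -/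
theorem helper_tate_eigenline_global (hmult : W.HasMultiplicativeReductionAt v) :
    ∃ ε : absoluteGaloisGroup (v.adicCompletion K) → ℤ,
      (∀ σ, ε σ = 1 ∨ ε σ = -1) ∧
      ∀ (p : ℕ), p.Prime → ∀ ζ : AlgebraicClosure K, ζ ^ p = 1 → ζ ≠ 1 →
        ∃ P : geomPoints W, P ≠ 0 ∧ p • P = 0 ∧
          ∀ σ : absoluteGaloisGroup (v.adicCompletion K),
            resGal (K := K) (v.adicCompletion K) σ • ζ = ζ →
              resGal (K := K) (v.adicCompletion K) σ • P = ε σ • P := by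
  obtain ⟨q, t, Ψ, hq0, hq1, -, -, -, -, -, hker, htw⟩ :=
    TateCurve.exists_twistedTateUniformisation_tateJ W v hmult
  refine ⟨fun σ ↦ if Field.absoluteGaloisGroup.toAlgEquiv (v.adicCompletion K) σ t = t then (1 : ℤ)
      else -1, fun σ ↦ ?_, fun p hp ζ hζp hζ1 ↦ ?_⟩
  · by_cases h : Field.absoluteGaloisGroup.toAlgEquiv (v.adicCompletion K) σ t = t
    · exact Or.inl (if_pos h)
    · exact Or.inr (if_neg h)
  haveI : Fact p.Prime := ⟨hp⟩
  -- E1′: the unit `u = ι(ζ) ∈ K̄_vˣ`; E1: the eigenpoint `L = Ψ(u)`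
  obtain ⟨u, hu, hup, hu1, hufix⟩ := helper_unit_of_closureEmb (K := K) v hp hζp hζ1
  obtain ⟨hL0, hpL, hLσ⟩ := helper_tate_eigenpoint_local W v hq0 hq1 Ψ hker
    (fun σ ↦ if Field.absoluteGaloisGroup.toAlgEquiv (v.adicCompletion K) σ t = t then (1 : ℤ)
      else -1) htw hup hu1
  -- IMPORT 5: the eigenpoint comes from `E(K̄)`
  have hpL' : p • Ψ (Additive.ofMul u) = 0 := by rw [← natCast_zsmul]; exact hpL
  obtain ⟨P, hpP, hPL⟩ := exists_pointsMapOfEmb_eq_of_nsmul_eq_zero W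
    (closureEmb (K := K) (v.adicCompletion K)) hp.ne_zero hpL'
  have hinj : Function.Injective (pointsMap W (v.adicCompletion K)) := pointsMapOfEmb_injective W _
  refine ⟨P, ?_, hpP, fun σ hσ ↦ hinj ?_⟩
  · rintro rfl
    exact hL0 (by rw [← hPL, map_zero])
  · have key := hLσ σ (hufix σ hσ)
    rw [← hPL] at key
    rw [pointsMap_smul, map_zsmul]
    exact key

/-- **E3 (PROVED here, pure algebra) — the sign is read off at an ODD level.** If `ε ∈ {±1}`,
`P ≠ 0` is `p`-torsion with `p` odd and `ε • P = -P`, then `ε = -1`. (Used with `p = 5`.) -/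
theorem helper_sign_eq_neg_one {A : Type*} [AddCommGroup A] {P : A} (hP : P ≠ 0) {p : ℕ}
    (hp : Odd p) (hpP : p • P = 0) {ε : ℤ} (hε : ε = 1 ∨ ε = -1) (h : ε • P = -P) : ε = -1 := by
  rcases hε with rfl | rfl
  · exfalso
    rw [one_zsmul] at h
    have h2 : 2 • P = 0 := by rw [two_nsmul]; nth_rw 1 [h]; exact neg_add_cancel P
    have hd : addOrderOf P ∣ 1 := by
      have := Nat.dvd_gcd (addOrderOf_dvd_of_nsmul_eq_zero h2) (addOrderOf_dvd_of_nsmul_eq_zero hpP)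
      rwa [Nat.Coprime.gcd_eq_one (Nat.coprime_two_left.mpr hp)] at this
    exact hP (AddMonoid.addOrderOf_eq_one_iff.mp (Nat.dvd_one.mp hd))
  · rfl

/-- **E4 (PROVED here; pure import) — conjugating a decomposition-group element onto `Γ_{K_v}`.**  If `φ ∈ D_𝔓` for a
prime `𝔓` above `v`, then `φ = g · σ|_{K̄} · g⁻¹` for some `g ∈ Γ_K`, `σ ∈ Γ_{K_v}`
(IMPORT 4: `g • 𝔓₀ = 𝔓`; IMPORT 2: `D_{𝔓₀} = range resGal`; `MulAction.stabilizer_smul_eq_stabilizer_map_conj`). -/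
theorem helper_conj_resGal_of_mem_decompositionSubgroup {𝔓 : Ideal (absIntegers (𝓞 K) K)}
    (h𝔓 : 𝔓 ∈ v.primesAbove) {φ : absoluteGaloisGroup K}
    (hφ : φ ∈ 𝔓.decompositionSubgroup (absoluteGaloisGroup K)) :
    ∃ (g : absoluteGaloisGroup K) (σ : absoluteGaloisGroup (v.adicCompletion K)),
      φ = g * resGal (K := K) (v.adicCompletion K) σ * g⁻¹ := by
  obtain ⟨g, hg⟩ := HeightOneSpectrum.exists_smul_eq_of_mem_primesAbove_holds
    (adicCompletionPrime_mem_primesAbove K v) h𝔓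
  subst hg
  rw [Ideal.decompositionSubgroup_smul, Subgroup.mem_pointwise_smul_iff_inv_smul_mem,
    decompositionSubgroup_adicCompletionPrime_eq_range] at hφ
  obtain ⟨σ, hσ⟩ := MonoidHom.mem_range.mp hφ
  refine ⟨g, σ, ?_⟩
  rw [resGal_eq_absGaloisRestrict]
  change φ = g * (absGaloisRestrict K (v.adicCompletion K)).toMonoidHom σ * g⁻¹
  rw [hσ, MulAut.smul_def, MulAut.conj_inv_apply]
  group

/-- **E5 (PROVED here) — `χ̄_N(σ) = 1` means `σ` fixes the `N`-th roots of unity of `K̄`**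
(`modNCyclotomicCharacter_spec`).  Turns k2-g8's hypotheses `h3`/`h5` into the fixing hypotheses of E2,
conjugation-invariantly (`χ̄_N` is a homomorphism to an abelian group). -/
theorem helper_smul_eq_self_of_modNCyclotomicCharacter_eq_one {N : ℕ} [NeZero N]
    {σ : absoluteGaloisGroup K} (hσ : modNCyclotomicCharacter K N σ = 1) {ζ : AlgebraicClosure K}
    (hζ : ζ ^ N = 1) : σ • ζ = ζ := by
  have h := modNCyclotomicCharacter_spec K N σ ζ hζ
  rw [hσ, Units.val_one] at h
  rcases Nat.lt_or_ge 1 N with hN | hN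
  · haveI : Fact (1 < N) := ⟨hN⟩
    rwa [ZMod.val_one, pow_one] at h
  · have hN1 : N = 1 := le_antisymm hN (Nat.pos_of_ne_zero (NeZero.ne N))
    subst hN1
    rw [pow_one] at hζ
    rw [hζ, smul_one]

omit [NumberField K] [W.IsElliptic] in
/-- **E5′ (PROVED here) — `φ = -1` on `E[n]` is conjugation-invariant.** -/
theorem helper_neg_conj {n : ℤ} {φ g : absoluteGaloisGroup K}
    (hneg : ∀ P : W.geomTorsion n, φ • P = -P) (P : W.geomTorsion n) :
    (g⁻¹ * φ * g) • P = -P := by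
  rw [mul_smul, mul_smul, hneg, smul_neg, inv_smul_smul]

end Global

/-! #### §T.2 (k1) The road-facing outputs (currency of Piece C `SurjThreeOfCuspData`) -/

/-- **E6 = N1e (PROVED here from E2–E5; only E2 is open) — a `-1`-EIGENVECTOR of `Frob_q` on `E[3]`.**  `E/ℚ` multiplicative
at `v`, `φ` a Frobenius at `𝔓 ∣ v` with `χ̄₃(φ) = χ̄₅(φ) = 1` acting as `-1` on `E[5]` ⇒ some
`P ∈ E[3] ∖ 0` has `φ • P = -P`.  Assembly: IMPORT 3 + E4 (`φ = g σ|_{K̄} g⁻¹`), E5 (`σ|_{K̄}` fixes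
`ζ₃, ζ₅`), E2 at `p = 5` with E5′ + E3 (`ε σ = -1`), E2 at `p = 3` (`σ|_{K̄} • P₃ = -P₃`), `P := g • P₃`.
SAME hypotheses as k2-g8 T2; no `q`, valid also for `v ∣ 15`. -/
theorem helper_frob_neg_eigenvector_three (E : WeierstrassCurve ℚ) [E.IsElliptic]
    {v : HeightOneSpectrum (𝓞 ℚ)} (hmult : E.HasMultiplicativeReductionAt v)
    {𝔓 : Ideal (absIntegers (𝓞 ℚ) ℚ)} (h𝔓 : 𝔓 ∈ v.primesAbove) {φ : absoluteGaloisGroup ℚ}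
    (hφ : IsArithFrobAt (𝓞 ℚ) φ 𝔓) (h3 : modNCyclotomicCharacter ℚ 3 φ = 1)
    (h5 : modNCyclotomicCharacter ℚ 5 φ = 1) (hneg : ∀ P : E.geomTorsion 5, φ • P = -P) :
    ∃ P : E.geomTorsion 3, P ≠ 0 ∧ φ • P = -P := by
  haveI := h𝔓.1
  -- E4: `φ = g σ|_{K̄} g⁻¹`
  obtain ⟨g, σ, hφg⟩ :=
    helper_conj_resGal_of_mem_decompositionSubgroup (K := ℚ) h𝔓 hφ.mem_stabilizer
  have hφ' : resGal (K := ℚ) (v.adicCompletion ℚ) σ = g⁻¹ * φ * g := by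
    rw [hφg]; group
  -- E2: the global eigenline with its common sign `ε`
  obtain ⟨ε, hε, hline⟩ := helper_tate_eigenline_global E hmult
  -- E5: `σ|_{K̄}` fixes `ζ₃`, `ζ₅` (cyclotomic characters are conjugation-invariant)
  have hfix : ∀ (N : ℕ) [NeZero N], modNCyclotomicCharacter ℚ N φ = 1 →
      ∀ ζ : AlgebraicClosure ℚ, ζ ^ N = 1 → resGal (K := ℚ) (v.adicCompletion ℚ) σ • ζ = ζ := by
    intro N _ hN ζ hζ
    refine helper_smul_eq_self_of_modNCyclotomicCharacter_eq_one ?_ hζ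
    rw [hφ', map_mul, map_mul, hN, mul_one, map_inv, inv_mul_cancel]
  -- E5′: `g⁻¹ φ g = -1` on `E[5]`, read in `E(K̄)`
  have hconj : ∀ (P : geomPoints E) (hP : P ∈ E.geomTorsion 5), (g⁻¹ * φ * g) • P = -P :=
    fun P hP ↦ congrArg Subtype.val (helper_neg_conj E (g := g) hneg ⟨P, hP⟩)
  have hmem : ∀ (n : ℕ) (P : geomPoints E), n • P = 0 → P ∈ E.geomTorsion n := by
    intro n P h
    refine (Submodule.mem_torsionBy_iff _ _).mpr ?_
    change ((n : ℕ) : ℤ) • P = 0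
    rw [natCast_zsmul, h]
  -- level 5: the sign `ε σ = -1` (E3)
  obtain ⟨ζ₅, hζ₅⟩ := HasEnoughRootsOfUnity.prim (M := AlgebraicClosure ℚ) (n := 5)
  obtain ⟨P₅, hP₅0, h5P₅, hP₅⟩ :=
    hline 5 (by norm_num) ζ₅ hζ₅.pow_eq_one (hζ₅.ne_one (by norm_num))
  have hεσ : ε σ = -1 := by
    have h1 := hP₅ σ (hfix 5 h5 ζ₅ hζ₅.pow_eq_one)
    have h2 : resGal (K := ℚ) (v.adicCompletion ℚ) σ • P₅ = -P₅ := by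
      rw [hφ']; exact hconj P₅ (hmem 5 P₅ h5P₅)
    exact helper_sign_eq_neg_one hP₅0 ⟨2, by norm_num⟩ h5P₅ (hε σ) (h1.symm.trans h2)
  -- level 3: the `-1`-eigenvector, conjugated back by `g`
  obtain ⟨ζ₃, hζ₃⟩ := HasEnoughRootsOfUnity.prim (M := AlgebraicClosure ℚ) (n := 3)
  obtain ⟨P₃, hP₃0, h3P₃, hP₃⟩ :=
    hline 3 (by norm_num) ζ₃ hζ₃.pow_eq_one (hζ₃.ne_one (by norm_num))
  have h3' : (g⁻¹ * φ * g) • P₃ = -P₃ := by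
    rw [← hφ', hP₃ σ (hfix 3 h3 ζ₃ hζ₃.pow_eq_one), hεσ, neg_one_zsmul]
  refine ⟨⟨g • P₃, smul_mem_torsionBy g (hmem 3 P₃ h3P₃)⟩, fun h0 ↦ hP₃0 ?_, Subtype.ext ?_⟩
  · have h0' : g • P₃ = 0 := by simpa using congrArg Subtype.val h0
    exact (smul_eq_zero_iff_eq g).mp h0'
  · show φ • g • P₃ = -(g • P₃)
    have h4 := congrArg (g • ·) h3'
    simp only [smul_smul, smul_neg] at h4
    rwa [show g * (g⁻¹ * φ * g) = φ * g by group, mul_smul] at h4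

/-- **E7 = T2′ (PROVED here; IMPORTS 7–8) — Cayley–Hamilton closes k2-g8 T2 VERBATIM.**  A `-1`-eigenvector on `E[3]` plus
`det ρ̄₃(φ) = χ̄₃(φ) = 1` give `(φ + 1)² = 0` on `E[3]`: in the frame `exists_frame_galoisRepTorsion_rat`
(IMPORT 7 / `det Φ = χ̄`), apply IMPORT 8 to `-M` (`det (-M) = det M` for `2 × 2`).
Honours `Disproof.switch_false_without_det` (the determinant is used). -/
theorem helper_addOneSq_of_neg_eigenvector (E : WeierstrassCurve ℚ) [E.IsElliptic]
    {φ : absoluteGaloisGroup ℚ} (h3 : modNCyclotomicCharacter ℚ 3 φ = 1)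
    {P : E.geomTorsion 3} (hP : P ≠ 0) (hφP : φ • P = -P) :
    ∀ Q : E.geomTorsion 3, φ • (φ • Q + Q) + (φ • Q + Q) = 0 := by
  haveI : Fact (Nat.Prime 3) := ⟨by norm_num⟩
  obtain ⟨e, Φ, he, -, hdet, -⟩ := exists_frame_galoisRepTorsion_rat E 3
  set M : Matrix (Fin 2) (Fin 2) (ZMod 3) :=
    ((Φ (galoisRepTorsion E ((3 : ℕ) : ℤ) φ) : GL (Fin 2) (ZMod 3)) : Matrix (Fin 2) (Fin 2) (ZMod 3))
    with hM
  -- the frame: `e (φ • Q) = M e(Q)`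
  have hMv : ∀ Q : E.geomTorsion 3, e (φ • Q) = M *ᵥ e Q := fun Q ↦ by
    rw [← galoisRepTorsion_apply]; exact he _ Q
  -- `det M = χ̄₃(φ) = 1` (this is where the determinant is used: `Disproof.switch_false_without_det`)
  have hdetM : M.det = 1 := by
    have h := hdet φ
    rw [modPCyclotomicCharacterZMod_eq_modNCyclotomicCharacter, h3] at h
    rw [hM, ← Matrix.GeneralLinearGroup.val_det_apply, h, Units.val_one]
  -- the `-1`-eigenvector in coordinates
  have hc : M *ᵥ e P = -(e P) := by rw [← hMv, hφP, map_neg]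
  have hc0 : e P ≠ 0 := fun h ↦ hP (by simpa using congrArg e.symm h)
  have hunit : IsUnit (e P 0) ∨ IsUnit (e P 1) := by
    by_contra hcon
    simp only [not_or, isUnit_iff_ne_zero, ne_eq, not_not] at hcon
    apply hc0
    funext i
    fin_cases i
    · simpa using hcon.1
    · simpa using hcon.2
  -- Cayley–Hamilton for `-M` (IMPORT 8): `(-M - 1)² = 0`, i.e. `(M + 1)² = 0`
  have hneg : (-M) *ᵥ e P = e P := by rw [Matrix.neg_mulVec, hc, neg_neg]
  have hdet' : (-M).det = 1 := by
    rw [Matrix.det_fin_two] at hdetM ⊢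
    simp only [Matrix.neg_apply]
    linear_combination hdetM
  have hsq := mul_self_sub_one_eq_zero_of_mulVec_eq_of_det_eq_one (-M) (e P) hunit hneg hdet'
  have hsq' : (M + 1) * (M + 1) = 0 := by
    rw [show -M - 1 = -(M + 1) by abel, neg_mul_neg] at hsq
    exact hsq
  intro Q
  apply e.injective
  simp only [map_add, map_zero, hMv]
  have h : ((M + 1) * (M + 1)) *ᵥ e Q = 0 := by rw [hsq', Matrix.zero_mulVec]
  rwa [← Matrix.mulVec_mulVec, Matrix.add_mulVec, Matrix.one_mulVec, Matrix.add_mulVec,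
    Matrix.one_mulVec] at h

/-- **k2-g8 T2, DISCHARGED (sorry-free composition of E6 + E7)**: exactly the signature of
`StubSwitchK2G8.helper_frob_addOneSq_three`, so k2-g8's PROVED `surjThreeOfCuspData_of_helpers` is untouched and
its T1 (`helper_twistedTate_addOneSq_local`) is no longer needed. -/
theorem helper_frob_addOneSq_three (E : WeierstrassCurve ℚ) [E.IsElliptic]
    {v : HeightOneSpectrum (𝓞 ℚ)} (hmult : E.HasMultiplicativeReductionAt v)
    {𝔓 : Ideal (absIntegers (𝓞 ℚ) ℚ)} (h𝔓 : 𝔓 ∈ v.primesAbove) {φ : absoluteGaloisGroup ℚ}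
    (hφ : IsArithFrobAt (𝓞 ℚ) φ 𝔓) (h3 : modNCyclotomicCharacter ℚ 3 φ = 1)
    (h5 : modNCyclotomicCharacter ℚ 5 φ = 1) (hneg : ∀ P : E.geomTorsion 5, φ • P = -P) :
    ∀ Q : E.geomTorsion 3, φ • (φ • Q + Q) + (φ • Q + Q) = 0 := by
  obtain ⟨P, hP, hφP⟩ := helper_frob_neg_eigenvector_three E hmult h𝔓 hφ h3 h5 hneg
  exact helper_addOneSq_of_neg_eigenvector E h3 hP hφP

/-- **FIN2 (S−, linear algebra over `𝔽₃`): `(φ+1)² = 0` on `E[3]` ⇒ `φ = −1` on every `φ`-stable line.** -/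
theorem helper_neg_on_line_of_add_one_sq (E : WeierstrassCurve ℚ) [E.IsElliptic]
    {φ : absoluteGaloisGroup ℚ} (hφ : ∀ Q : E.geomTorsion 3, φ • (φ • Q + Q) + (φ • Q + Q) = 0)
    {P : E.geomTorsion 3} (hP0 : P ≠ 0) (hst : φ • P ∈ AddSubgroup.zmultiples P) :
    φ • P = -P := by
  sorry

/-- **R1 (S): reducible ⇒ a `Γ_ℚ`-stable line** (a proper non-zero stable subgroup of `E[3] ≅ 𝔽₃²`). -/
theorem helper_stable_line_of_not_irreducible (E : WeierstrassCurve ℚ) [E.IsElliptic]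
    (h : ¬ E.HasIrreducibleModPGaloisRep 3) :
    ∃ P : E.geomTorsion 3, P ≠ 0 ∧
      ∀ σ : absoluteGaloisGroup ℚ, σ • P ∈ AddSubgroup.zmultiples P := by
  sorry

/-- **R3 (S−; = tree `Mazur1978.exists_isogenyCharacter` + `isOpen_ker_galoisRepTorsion_holds`): the
character of a stable line, with open kernel.** -/
theorem helper_lineChar (E : WeierstrassCurve ℚ) [E.IsElliptic] {P : E.geomTorsion 3} (hP0 : P ≠ 0)
    (hst : ∀ σ : absoluteGaloisGroup ℚ, σ • P ∈ AddSubgroup.zmultiples P) :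
    ∃ r : absoluteGaloisGroup ℚ →* (ZMod 3)ˣ,
      IsOpen ((r.ker : Subgroup (absoluteGaloisGroup ℚ)) : Set (absoluteGaloisGroup ℚ)) ∧
      ∀ σ : absoluteGaloisGroup ℚ, σ • P = ((r σ : (ZMod 3)ˣ) : ZMod 3).val • P := by
  sorry

/-- **Rneg (S−): a line character takes the value `−1` at `φ` when `φ • P = −P`.** -/
theorem helper_character_neg_one (E : WeierstrassCurve ℚ) [E.IsElliptic]
    {P : E.geomTorsion 3} (hP0 : P ≠ 0) {r : absoluteGaloisGroup ℚ →* (ZMod 3)ˣ}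
    (hr : ∀ σ : absoluteGaloisGroup ℚ, σ • P = ((r σ : (ZMod 3)ˣ) : ZMod 3).val • P)
    {φ : absoluteGaloisGroup ℚ} (hφ : φ • P = -P) : r φ = -1 := by
  sorry

/-- **R2 (S, NOW TREE-BACKED): a line character is unramified at every semistable `w ∤ 3`.**  Good:
`smul_geomTorsion_eq_of_mem_inertia`; multiplicative: the PROVED global Tate basis
`exists_tateBasis_geomTorsion_of_hasMultiplicativeReductionAt` (`p = 3`, `n = 1`: inertia fixes `P₁` and
moves `P₂` inside `P₂ + ℤP₁`, so its only possible eigenvalue on a stable line is `1`). -/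
theorem helper_lineChar_unramified (E : WeierstrassCurve ℚ) [E.IsElliptic] {P : E.geomTorsion 3}
    (hP0 : P ≠ 0) {r : absoluteGaloisGroup ℚ →* (ZMod 3)ˣ}
    (hr : ∀ σ : absoluteGaloisGroup ℚ, σ • P = ((r σ : (ZMod 3)ˣ) : ZMod 3).val • P)
    {w : HeightOneSpectrum (𝓞 ℚ)} (h3w : ((3 : ℕ) : 𝓞 ℚ) ∉ w.asIdeal) (hw : E.IsSemistableAt w)
    {𝔓 : Ideal (absIntegers (𝓞 ℚ) ℚ)} (h𝔓 : 𝔓 ∈ w.primesAbove)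
    {σ : absoluteGaloisGroup ℚ} (hσ : σ ∈ 𝔓.inertia (absoluteGaloisGroup ℚ)) : r σ = 1 := by
  sorry

/-- **R4e (S−): `a ≡ 1 (mod p)` ⇒ `a^{p^k} ≡ 1 (mod p^{k+1})`.** -/
theorem helper_pow_prime_pow_congr_one {p : ℕ} (hp : p.Prime) (k : ℕ) {a : ℤ}
    (ha : a ≡ 1 [ZMOD p]) : a ^ p ^ k ≡ 1 [ZMOD (p : ℤ) ^ (k + 1)] := by
  sorry

/-- **R4d (S−): `a ≡ 1 (mod 8)` ⇒ `a` is a square mod `2^e`.** -/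
theorem helper_sq_congr_of_one_mod_eight (e : ℕ) {a : ℤ} (ha : a ≡ 1 [ZMOD 8]) :
    ∃ x : ℤ, x ^ 2 ≡ a [ZMOD (2 : ℤ) ^ e] := by
  sorry

/-- **R4c (S/M−, pure `(ℤ/n)ˣ`):** `8 ∣ m ∣ n`, `β : (ℤ/n)ˣ → (ℤ/3)ˣ` trivial on the full `p`-component for
every prime `p ∣ n`, `p ∤ m` ⇒ `β` is trivial on `ker((ℤ/n)ˣ → (ℤ/m)ˣ)` (CRT + R4d + R4e; no
unramifiedness at the primes of `m` is ever needed). -/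
theorem helper_ker_unitsMap_le_ker {n m : ℕ} [NeZero n] (hmn : m ∣ n) (h8 : 8 ∣ m)
    (β : (ZMod n)ˣ →* (ZMod 3)ˣ)
    (hβ : ∀ p : ℕ, p.Prime → p ∣ n → ¬ p ∣ m →
      ∀ a : (ZMod n)ˣ, ZMod.unitsMap (Nat.ordCompl_dvd n p) a = 1 → β a = 1)
    (a : (ZMod n)ˣ) (ha : ZMod.unitsMap hmn a = 1) : β a = 1 := by
  sorry

/-- **R4b (S): unramified at `p` ⇒ `β` kills the `p`-component** (tree
`exists_mem_inertia_modNCyclotomicCharacter_eq`). -/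
theorem helper_beta_eq_one_of_unramified (ψ : absoluteGaloisGroup ℚ →* (ZMod 3)ˣ)
    {n : ℕ} [NeZero n] (β : (ZMod n)ˣ →* (ZMod 3)ˣ)
    (hβ : ∀ σ : absoluteGaloisGroup ℚ, β (modNCyclotomicCharacter ℚ n σ) = ψ σ)
    {p : ℕ} (hp : p.Prime) {w : HeightOneSpectrum (𝓞 ℚ)} (hw : (p : 𝓞 ℚ) ∈ w.asIdeal)
    (hunr : ∀ 𝔓 ∈ w.primesAbove, ∀ σ ∈ 𝔓.inertia (absoluteGaloisGroup ℚ), ψ σ = 1)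
    (a : (ZMod n)ˣ) (ha : ZMod.unitsMap (Nat.ordCompl_dvd n p) a = 1) : β a = 1 := by
  sorry

/-- **R4 (S given R4b/R4c; Kronecker–Weber = tree PROVED `exists_comp_modNCyclotomicCharacter_eq`):** a
character `Γ_ℚ → (ℤ/3)ˣ` with open kernel, unramified at every `w ∤ m` (`8 ∣ m`), takes equal values on
elements with equal `χ̄_m`.  Consumed with `σ = Frob_q`, `σ' = τ²`: `ψ(Frob_q) = ψ(τ)² = 1`. -/
theorem helper_char_eq_of_cyclotomic_eq {m : ℕ} [NeZero m] (h8 : 8 ∣ m)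
    (ψ : absoluteGaloisGroup ℚ →* (ZMod 3)ˣ)
    (hker : IsOpen ((ψ.ker : Subgroup (absoluteGaloisGroup ℚ)) : Set (absoluteGaloisGroup ℚ)))
    (hunr : ∀ (w : HeightOneSpectrum (𝓞 ℚ)), (m : 𝓞 ℚ) ∉ w.asIdeal →
      ∀ 𝔓 ∈ w.primesAbove, ∀ σ ∈ 𝔓.inertia (absoluteGaloisGroup ℚ), ψ σ = 1)
    {σ σ' : absoluteGaloisGroup ℚ}
    (hσ : modNCyclotomicCharacter ℚ m σ = modNCyclotomicCharacter ℚ m σ') : ψ σ = ψ σ' := by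
  sorry

/-- **R5 (S given the tree): irreducible and `3 ∣ #ρ̄_{E,3}(Γ_ℚ)` ⇒ onto `GL₂(𝔽₃)`** (two transvections
with distinct lines generate `SL₂(𝔽₃)` — all conjugates of the transvection share a line only if that line
is stable; `det = χ̄₃` onto). -/
theorem helper_surjective_three_of_irreducible_of_three_dvd (E : WeierstrassCurve ℚ) [E.IsElliptic]
    (hirr : E.HasIrreducibleModPGaloisRep 3)
    (h3 : 3 ∣ Nat.card (galoisRepTorsion E ((3 : ℕ) : ℤ)).range) :
    E.HasSurjectiveModNGaloisRep ((3 : ℕ) : ℤ) := by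
  sorry

/-! ## §G PROVED GLUE: the helpers give Pieces B and C (every helper conclusion consumed by name) -/

/-- coprimality plumbing (PROVED): a place containing the prime `q ≠ 3` does not contain `3`. -/
theorem helper_three_not_mem {q : ℕ} (hq : q.Prime) (hq3 : q ≠ 3) {v : HeightOneSpectrum (𝓞 ℚ)}
    (hv : (q : 𝓞 ℚ) ∈ v.asIdeal) : ((3 : ℕ) : 𝓞 ℚ) ∉ v.asIdeal := by
  intro h3
  have hcop : Nat.Coprime 3 q := (Nat.coprime_primes Nat.prime_three hq).mpr hq3.symm
  obtain ⟨a, b, hab⟩ := Nat.isCoprime_iff_coprime.mpr hcop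
  have hab' : (a : 𝓞 ℚ) * ((3 : ℕ) : 𝓞 ℚ) + (b : 𝓞 ℚ) * (q : 𝓞 ℚ) = 1 := by
    have h := congrArg (Int.cast : ℤ → 𝓞 ℚ) hab
    simpa using h
  apply v.isPrime.ne_top
  rw [Ideal.eq_top_iff_one, ← hab']
  exact v.asIdeal.add_mem (v.asIdeal.mul_mem_left _ h3) (v.asIdeal.mul_mem_left _ hv)

/-- **Piece B from its helpers, the tree's Chebotarev fact and Fisher's named fact (PROVED GLUE).** -/
theorem cuspMemberSource_of_helpers (hF : thm132_geomTorsionFive_of_hesseFamily) :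
    CuspMemberSource := by
  intro c₄ c₆ hΔ _ M _ τ hMdvd hτ hχ5
  have hM0 : M ≠ 0 := NeZero.ne M
  have h30M : 30 * (c₄ ^ 3 - c₆ ^ 2).natAbs ∣ M :=
    dvd_trans (mul_dvd_mul_right (by norm_num) _) hMdvd
  have h330M : 330 * (c₄ ^ 3 - c₆ ^ 2).natAbs ∣ M :=
    dvd_trans (mul_dvd_mul_right (by norm_num) _) hMdvd
  have h5M : 5 ∣ M := dvd_trans (dvd_mul_of_dvd_left (by norm_num) _) hMdvd
  have h3M : 3 ∣ M := dvd_trans (dvd_mul_of_dvd_left (by norm_num) _) hMdvd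
  have h8M : 8 ∣ M := dvd_trans (dvd_mul_of_dvd_left (by norm_num) _) hMdvd
  have h2M : 2 ≤ M := by obtain ⟨k, hk⟩ := h8M; omega
  -- B1: Chebotarev for `base[M]`, `σ = τ²`, avoiding the primes dividing `M`
  obtain ⟨q, v, 𝔓, φ, hq, hqS, hv, h𝔓, hφ, hφτ⟩ :=
    chebotarev_geomTorsion_holds (base (c₄ : ℚ) (c₆ : ℚ)) (M : ℤ) (by exact_mod_cast hM0)
      (↑(Nat.divisors M)) (Finset.finite_toSet _) (τ * τ)
  have hqM : ¬ q ∣ M := fun h => hqS (Finset.mem_coe.mpr (Nat.mem_divisors.mpr ⟨h, hM0⟩))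
  have hq30 : ¬ (q : ℤ) ∣ 30 * (c₄ ^ 3 - c₆ ^ 2) := by
    intro h
    have h1 := Int.natCast_dvd.mp h
    rw [Int.natAbs_mul, show (30 : ℤ).natAbs = 30 from rfl] at h1
    exact hqM (dvd_trans h1 h30M)
  have hq330 : ¬ (q : ℤ) ∣ 330 * (c₄ ^ 3 - c₆ ^ 2) := by
    intro h
    have h1 := Int.natCast_dvd.mp h
    rw [Int.natAbs_mul, show (330 : ℤ).natAbs = 330 from rfl] at h1
    exact hqM (dvd_trans h1 h330M)
  -- B2/B3/B4: `φ = −1` on `base[5]`, `χ̄₅(φ) = χ̄₃(φ) = 1`, `χ̄_M(φ) = χ̄_M(τ²)`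
  have h5' : ∀ P : (base (c₄ : ℚ) (c₆ : ℚ)).geomTorsion ((5 : ℕ) : ℤ), φ • P = (τ * τ) • P :=
    fun P => helper_smul_eq_of_dvd _ (by exact_mod_cast h5M) hφτ P
  have h3' : ∀ P : (base (c₄ : ℚ) (c₆ : ℚ)).geomTorsion ((3 : ℕ) : ℤ), φ • P = (τ * τ) • P :=
    fun P => helper_smul_eq_of_dvd _ (by exact_mod_cast h3M) hφτ P
  have hnegB : ∀ P : (base (c₄ : ℚ) (c₆ : ℚ)).geomTorsion 5, φ • P = -P := fun P => by
    rw [h5' P, mul_smul, hτ P]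
  have hχ5φ : modNCyclotomicCharacter ℚ 5 φ = 1 := by
    rw [helper_cyclotomic_eq_of_smul_eq (n := 5) (base (c₄ : ℚ) (c₆ : ℚ)) (by norm_num) h5', hχ5]
  have hχ3φ : modNCyclotomicCharacter ℚ 3 φ = 1 := by
    rw [helper_cyclotomic_eq_of_smul_eq (n := 3) (base (c₄ : ℚ) (c₆ : ℚ)) (by norm_num) h3',
      helper_chi3_sq]
  have hχM : modNCyclotomicCharacter ℚ M φ = modNCyclotomicCharacter ℚ M (τ * τ) :=
    helper_cyclotomic_eq_of_smul_eq (base (c₄ : ℚ) (c₆ : ℚ)) h2M hφτ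
  -- B6/B7: the cusp-adjacent parameter `l`
  obtain ⟨r, hr⟩ := helper_D_root_mod_q c₄ c₆ hΔ hq hq30 hv h𝔓 hφ hχ5φ hnegB
  obtain ⟨l, hl⟩ := helper_lift_root hq c₄ c₆ r hq30 hr
  -- B8: elliptic, multiplicative at `q`, `v_q(Δ_min) = 5`
  obtain ⟨hEll, hmult, hord⟩ := helper_member_multiplicative c₄ c₆ l hΔ hq hq330 hl hv
  haveI := hEll
  -- F1: the `5`-congruence (Fisher Thm 13.2, named fact)
  have hcongr : Congr (member (c₄ : ℚ) (c₆ : ℚ) (l : ℚ) 1) (base (c₄ : ℚ) (c₆ : ℚ)) :=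
    congr_member_base hF (c₄ : ℚ) (c₆ : ℚ) (l : ℚ)
  refine ⟨l, hEll, q, v, 𝔓, φ, hq, hqM, hv, h𝔓, hφ, hcongr, ?_, hmult, hord, ?_, hχ3φ, hχ5φ, hχM⟩
  · -- B9: semistable away from `M`
    intro w hw
    refine helper_isSemistableAt_member c₄ c₆ l hΔ hcongr fun h => hw ?_
    obtain ⟨k, hk⟩ := h30M
    rw [hk, Nat.cast_mul]
    exact Ideal.mul_mem_right _ _ h
  · -- `φ = −1` on `member[5]` through the equivariant `e`
    obtain ⟨e, he⟩ := hcongr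
    intro P
    apply e.injective
    rw [he, hnegB, map_neg]

/-- **Piece C from its helpers and the tree's inertial transvection (PROVED GLUE).** -/
theorem surjThreeOfCuspData_of_helpers : SurjThreeOfCuspData := by
  intro E _ M _ q v 𝔓 φ τ h8 h3M hss hq hqM hv h𝔓 hφ hmult hord hneg h3 h5 hM
  have hq3 : q ≠ 3 := by rintro rfl; exact hqM h3M
  have h3v : ((3 : ℕ) : 𝓞 ℚ) ∉ v.asIdeal := helper_three_not_mem hq hq3 hv
  have hdvd : 3 ∣ Nat.card (galoisRepTorsion E ((3 : ℕ) : ℤ)).range :=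
    E.dvd_card_range_galoisRepTorsion_of_hasMultiplicativeReductionAt_of_not_dvd hmult
      Nat.prime_three h3v (by rw [hord]; decide)
  refine helper_surjective_three_of_irreducible_of_three_dvd E ?_ hdvd
  by_contra hirr
  obtain ⟨P, hP0, hst⟩ := helper_stable_line_of_not_irreducible E hirr
  obtain ⟨r, hker, hr⟩ := helper_lineChar E hP0 hst
  have hφP : φ • P = -P :=
    helper_neg_on_line_of_add_one_sq E (helper_frob_addOneSq_three E hmult h𝔓 hφ h3 h5 hneg)
      hP0 (hst φ)
  have hr1 : r φ = -1 := helper_character_neg_one E hP0 hr hφP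
  have hunr : ∀ (w : HeightOneSpectrum (𝓞 ℚ)), (M : 𝓞 ℚ) ∉ w.asIdeal →
      ∀ 𝔓' ∈ w.primesAbove, ∀ σ ∈ 𝔓'.inertia (absoluteGaloisGroup ℚ), r σ = 1 := by
    intro w hw 𝔓' h𝔓' σ hσ
    have h3w : ((3 : ℕ) : 𝓞 ℚ) ∉ w.asIdeal := fun h => hw (by
      obtain ⟨k, hk⟩ := h3M
      rw [hk, Nat.cast_mul]
      exact Ideal.mul_mem_right _ _ h)
    exact helper_lineChar_unramified E hP0 hr h3w (hss w hw) h𝔓' hσ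
  have heq : r φ = r (τ * τ) := helper_char_eq_of_cyclotomic_eq h8 r hker hunr hM
  rw [map_mul, units_zmod3_mul_self] at heq
  rw [heq] at hr1
  exact absurd hr1 (by decide)

/-- **EVERYTHING ⇒ the registered stub (PROVED modulo the `sorry`'d helpers and the two named facts
`chebotarev_geomTorsion` (PROVED in the tree) and `thm132_geomTorsionFive_of_hesseFamily` (OPEN)).** -/
theorem stubSwitch_of_helpers (hF : thm132_geomTorsionFive_of_hesseFamily) : StubSwitch :=
  stubSwitch_of_pieces (squareSource_of negOneIsSquare) integralModel
    (cuspMemberSource_of_helpers hF) surjThreeOfCuspData_of_helpers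

/-! ## sanity: tree inputs consumed by the compositions exist with the expected shape -/

example : chebotarev_geomTorsion := chebotarev_geomTorsion_holds

example (E : WeierstrassCurve ℚ) [E.IsElliptic] {v : HeightOneSpectrum (𝓞 ℚ)}
    (hmult : E.HasMultiplicativeReductionAt v) (h3v : ((3 : ℕ) : 𝓞 ℚ) ∉ v.asIdeal)
    (h5 : E.ordMinimalDiscriminant v = 5) :
    3 ∣ Nat.card (galoisRepTorsion E ((3 : ℕ) : ℤ)).range :=
  E.dvd_card_range_galoisRepTorsion_of_hasMultiplicativeReductionAt_of_not_dvd hmult Nat.prime_three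
    h3v (by rw [h5]; decide)

example {K : Type} [Field K] [NumberField K] (W : WeierstrassCurve K) [W.IsElliptic]
    (v : HeightOneSpectrum (𝓞 K)) (h : W.HasMultiplicativeReductionAt v) :=
  TateCurve.exists_twistedTateUniformisation_tateJ W v h

example {K : Type} [Field K] [NumberField K] (W : WeierstrassCurve K) [W.IsElliptic]
    (v : HeightOneSpectrum (𝓞 K)) {m : ℕ} (hm3 : 3 ≤ m) (hmv : (m : 𝓞 K) ∉ v.asIdeal)
    (h : ∀ σ ∈ GreenbergSelmer.inertia v, ∀ Q : W.geomTorsion (m : ℤ), σ • Q = Q) :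
    W.IsSemistableAt v := by
  rw [isSemistableAt_iff_not_hasAdditiveReductionAt]
  intro hadd
  obtain ⟨σ, hσ, Q, hQ⟩ := W.exists_mem_inertia_smul_geomTorsion_ne_of_hasAdditiveReductionAt hadd hm3 hmv
  exact hQ (h σ hσ Q)

example {K : Type} [Field K] [NumberField K] (W : WeierstrassCurve K) [W.IsElliptic]
    {v : HeightOneSpectrum (𝓞 K)} (hv : W.HasGoodReductionAt v) {n : ℤ} (hn : (n : 𝓞 K) ∉ v.asIdeal)
    {τ : absoluteGaloisGroup K} (hτ : τ ∈ (adicCompletionPrime K v).inertia (absoluteGaloisGroup K))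
    (P : W.geomTorsion n) : τ • P = P :=
  W.smul_geomTorsion_eq_of_mem_inertia hv hn (adicCompletionPrime_mem_primesAbove K v) hτ P

end Summit.ABC.ABC.Cruxes.FreyModularity.StubSwitchK2G9

end
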